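import Literature.MathematicalPhysics.KineticTheory.TransportRegularityOfMixing
import Literature.MathematicalPhysics.KineticTheory.InfiniteChainL2Locality
import Literature.MathematicalPhysics.KineticTheory.InfiniteChainGeneratorLipschitz
import Literature.MathematicalPhysics.KineticTheory.InfiniteChainFlowNormalForm
import Literature.MathematicalPhysics.KineticTheory.InfiniteChainTwoPointContinuity
import Literature.MathematicalPhysics.KineticTheory.InfiniteChainSeveredGibbs
import HarnessLib

/-!
# `stub_regularTransport` — registered stub of line `temperature-blind-vitali-hurwitz`, crux `EmbeddedDrudeMourre.GreenKuboContinuation`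
(item stmt-AtomisticToContinuum-12597)

Target: `Summits/AtomisticToContinuum/FouriersLaw/Theorems/EmbeddedDrudeMourreGreenKuboContinuationRegularTransport.lean`
(`ledger propose --supports stmt-AtomisticToContinuum-12597`). The theorem name and signature below
are REGISTERED (`ledger workitem stubs stmt-AtomisticToContinuum-12597`) and stay verbatim.

## Content

For the pinned anharmonic chain `pinnedChain ω₂ lam β γ` (`U = ω₂q²/2 + lam q⁴/4`,
`V = r²/2 + βr⁴/4`, all parameters positive) and ANY infinite-volume dynamics `D` whose carrier is
Buttà–Marchioro's good set `𝒳₀` (BM 2016, Thm 2.1): given, at temperature `T > 0`, uniqueness of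
the DLR state in the regular class (DLR + shift-invariant + BM's superstability estimate (2.3)),
exponential `ρ`-mixing of every regular state and `C_μ(0) > 0` for every regular state preserved
by `D`, every regular state `μ` preserved by `D` has (i) an absolutely convergent space-summed
current autocorrelation `C_μ(t)` at every `t` and (ii) a positive Abel functional
`∫₀^∞ e^{-νt} C_μ(t) dt` for every `ν > 0`.

## Proof (all inputs in the tree)

1. Normal form: replace `D` by the dynamics `D'` with the same orbits on `𝒳₀` which is the
   identity off `𝒳₀` (`InfiniteChainDynamics.exists_normalForm_bmGood`); `D'` preserves `μ` and has
   the same `currentCorrelation μ` and `HasAbsConvergentCorrelation μ t`.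
2. Input (L): fixed-time `L²(μ)` locality of `j₀ ∘ φ_t`, `h₀ ∘ φ_t` with summable rate, locally
   uniformly in `t` (`InfiniteChainDynamics.exists_summable_l2_locality`, from BM §3 via
   `InfiniteChainFlowLocality` and the exponential tail (2.6); the generators are polynomially
   Lipschitz, `InfiniteChainGeneratorLipschitz`; the severed flows preserve the Gibbs state,
   LLL 1977 §4 (i)).
3. Assembly `InfiniteChainDynamics.transportRegular_of_mixing_of_locality`: (M) + (L) give the
   summable clustering of Doyon's generators (`ChainMixingClustering`), hence the zero-wavenumber
   data (`ZeroWavenumberDataOfClustering`); with the continuity in time of the two-point functions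
   (`InfiniteChainCorrelationContinuity`, `InfiniteChainTwoPointContinuity`) the Koopman group is
   strongly continuous (`FluctuationStrongContinuityGenerators`); uniqueness forces zero mean current
   and `ZeroWavenumberData.transportRegular_of_regular_unique` concludes.
-/

noncomputable section

namespace Summit.AtomisticToContinuum.FouriersLaw.Theorems.GreenKuboContinuation.TemperatureBlindVitaliHurwitz

open Filter Topology MeasureTheory Set
open Literature.MathematicalPhysics.KineticTheory.HeatConduction

/-- **Transport regularity of the regular states of the pinned anharmonic chain** (registered stub
`stub_regularTransport` of line temperature-blind-vitali-hurwitz): for `ω₂, lam, β, γ > 0`, a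
dynamics `D` with carrier `𝒳₀`, `T > 0`, uniqueness in the regular class at `T`, exponential
`ρ`-mixing of the regular states at `T` and `C_μ(0) > 0` for the regular states preserved by `D`,
every regular state `μ` preserved by `D` has an absolutely convergent summed current
autocorrelation at every time and a positive Abel functional `∫₀^∞ e^{-νt} C_μ(t) dt`, `ν > 0`.
[cite: ButtaMarchioro2016, §2 Thm 2.1 and §3] -/
theorem stub_regularTransport :
    ∀ ω₂ lam β γ : ℝ, 0 < ω₂ → 0 < lam → 0 < β → 0 < γ →
      ∀ D : Literature.MathematicalPhysics.KineticTheory.HeatConduction.InfiniteChainDynamics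
          (Literature.MathematicalPhysics.KineticTheory.HeatConduction.pinnedChain ω₂ lam β γ),
        D.carrier =
            (Literature.MathematicalPhysics.KineticTheory.HeatConduction.pinnedChain
                ω₂ lam β γ).bmGood →
        ∀ T : ℝ, 0 < T →
          (∀ μ₁ μ₂ : MeasureTheory.Measure
              Literature.MathematicalPhysics.KineticTheory.HeatConduction.ChainConfig,
            (Literature.MathematicalPhysics.KineticTheory.HeatConduction.pinnedChain
                ω₂ lam β γ).IsChainGibbsMeasure T μ₁ →
            Literature.MathematicalPhysics.KineticTheory.HeatConduction.IsShiftInvariant μ₁ →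
            (Literature.MathematicalPhysics.KineticTheory.HeatConduction.pinnedChain
                ω₂ lam β γ).HasSuperstabilityEstimate μ₁ →
            (Literature.MathematicalPhysics.KineticTheory.HeatConduction.pinnedChain
                ω₂ lam β γ).IsChainGibbsMeasure T μ₂ →
            Literature.MathematicalPhysics.KineticTheory.HeatConduction.IsShiftInvariant μ₂ →
            (Literature.MathematicalPhysics.KineticTheory.HeatConduction.pinnedChain
                ω₂ lam β γ).HasSuperstabilityEstimate μ₂ → μ₁ = μ₂) →
          (∀ μ : MeasureTheory.Measure
              Literature.MathematicalPhysics.KineticTheory.HeatConduction.ChainConfig,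
            (Literature.MathematicalPhysics.KineticTheory.HeatConduction.pinnedChain
                ω₂ lam β γ).IsChainGibbsMeasure T μ →
            Literature.MathematicalPhysics.KineticTheory.HeatConduction.IsShiftInvariant μ →
            (Literature.MathematicalPhysics.KineticTheory.HeatConduction.pinnedChain
                ω₂ lam β γ).HasSuperstabilityEstimate μ →
              ∃ C m : ℝ, 0 < m ∧ ∀ (a : ℤ) (n : ℕ) (f g : Literature.MathematicalPhysics.KineticTheory.HeatConduction.ChainConfig → ℝ),
                DependsOn f {i : ℤ | i ≤ a} → DependsOn g {i : ℤ | a + n ≤ i} →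
                Measurable f → Measurable g →
                MeasureTheory.MemLp f 2 μ → MeasureTheory.MemLp g 2 μ →
                |MeasureTheory.integral μ (fun σ => f σ * g σ) -
                    MeasureTheory.integral μ f * MeasureTheory.integral μ g| ≤
                  C * Real.exp (-(m * n)) * (MeasureTheory.integral μ (fun σ => f σ ^ 2)) ^ (1 / 2 : ℝ) *
                    (MeasureTheory.integral μ (fun σ => g σ ^ 2)) ^ (1 / 2 : ℝ)) →
          (∀ μ : MeasureTheory.Measure
              Literature.MathematicalPhysics.KineticTheory.HeatConduction.ChainConfig,
            (Literature.MathematicalPhysics.KineticTheory.HeatConduction.pinnedChain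
                ω₂ lam β γ).IsChainGibbsMeasure T μ →
            Literature.MathematicalPhysics.KineticTheory.HeatConduction.IsShiftInvariant μ →
            (Literature.MathematicalPhysics.KineticTheory.HeatConduction.pinnedChain
                ω₂ lam β γ).HasSuperstabilityEstimate μ →
            D.PreservesMeasure μ → 0 < D.currentCorrelation μ 0) →
          ∀ μ : MeasureTheory.Measure
              Literature.MathematicalPhysics.KineticTheory.HeatConduction.ChainConfig,
            (Literature.MathematicalPhysics.KineticTheory.HeatConduction.pinnedChain
                ω₂ lam β γ).IsChainGibbsMeasure T μ →
            Literature.MathematicalPhysics.KineticTheory.HeatConduction.IsShiftInvariant μ →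
            (Literature.MathematicalPhysics.KineticTheory.HeatConduction.pinnedChain
                ω₂ lam β γ).HasSuperstabilityEstimate μ →
            D.PreservesMeasure μ →
            (∀ t : ℝ, D.HasAbsConvergentCorrelation μ t) ∧
            ∀ ν : ℝ, 0 < ν →
              0 < MeasureTheory.integral (MeasureTheory.volume.restrict (Set.Ioi (0:ℝ)))
                (fun t : ℝ => Real.exp (-(ν * t)) * D.currentCorrelation μ t) := by
  intro ω₂ lam β γ hω hl hβ hγ D hcar T hT huniq hmix hG3 μ hG hS hss hD
  -- the chain data
  have hU1 : OscillatorChain.IsEvenPolyOfDegree (pinnedChain ω₂ lam β γ).U 2 :=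
    OscillatorChain.pinnedChain_isEvenPolyOfDegree_U β γ hω.le hl
  have hV1 : OscillatorChain.IsEvenPolyOfDegree (pinnedChain ω₂ lam β γ).V 2 :=
    OscillatorChain.pinnedChain_isEvenPolyOfDegree_V ω₂ lam γ hβ
  have hU0 : ∀ r, 0 ≤ (pinnedChain ω₂ lam β γ).U r := OscillatorChain.pinnedChain_U_nonneg β γ hω.le hl.le
  have hV0 : ∀ r, 0 ≤ (pinnedChain ω₂ lam β γ).V r := hV1.choose_spec.2.2
  have hU : ContDiff ℝ 2 (pinnedChain ω₂ lam β γ).U := hU1.contDiff_two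
  have hV : ContDiff ℝ 2 (pinnedChain ω₂ lam β γ).V := hV1.contDiff_two
  have hUc : Continuous (pinnedChain ω₂ lam β γ).U := hU.continuous
  have hUm : Measurable (pinnedChain ω₂ lam β γ).U := hU.continuous.measurable
  have hVm : Measurable (pinnedChain ω₂ lam β γ).V := hV.continuous.measurable
  have hB1 : (pinnedChain ω₂ lam β γ).CondB1 :=
    OscillatorChain.condB1_of_bddBelow _ hU hV ⟨0, by rintro _ ⟨q, rfl⟩; exact hU0 q⟩
      ⟨0, by rintro _ ⟨r, rfl⟩; exact hV0 r⟩
  haveI : IsProbabilityMeasure μ := hss.1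
  -- 1. normal form
  obtain ⟨D', hcar', -, hoff, hD', hcorr, habs⟩ := D.exists_normalForm_bmGood hUm hVm hcar hD
  -- 2. input (L) for `D'`
  have hsev : ∀ (n : ℕ) (t : ℝ), MeasurePreserving
      (OscillatorChain.severedFlow hB1 (Finset.Icc ((0 : ℤ) - n) ((0 : ℤ) + n)) t) μ μ := fun n t =>
    OscillatorChain.measurePreserving_severedFlow_of_isChainGibbsMeasure hU hV hB1 _ hG t
  have hpow4 : ∀ {a : ChainConfig → ℝ}, MemLp a 4 μ → Integrable (fun σ => a σ ^ 4) μ := by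
    intro a h4
    have h := h4.integrable_norm_pow' (p := 4)
    refine h.congr (Eventually.of_forall fun σ => ?_)
    simp only [Real.norm_eq_abs]
    exact Even.pow_abs (by decide) _
  have hloc : ∀ a ∈ ({fun σ => (pinnedChain ω₂ lam β γ).bondCurrentZ σ 0,
      fun σ => (pinnedChain ω₂ lam β γ).energyDensityZ σ 0} : Set (ChainConfig → ℝ)),
      ∀ τ : ℝ, 0 ≤ τ → ∃ ε : ℕ → ℝ, (∀ n, 0 ≤ ε n) ∧ Summable ε ∧ ∀ t : ℝ, |t| ≤ τ → ∀ n : ℕ,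
        ∃ g : ChainConfig → ℝ, DependsOn g (Icc (-(n : ℤ) - 1) (n + 1)) ∧ Measurable g ∧
          MemLp g 2 μ ∧ Real.sqrt (∫ σ, (a (D'.flow t σ) - g σ) ^ 2 ∂μ) ≤ ε n := by
    intro a ha τ hτ
    have hdata : Measurable a ∧ DependsOn a (Icc (-1 : ℤ) 1) ∧ MemLp a 2 μ ∧
        Integrable (fun σ => a σ ^ 4) μ ∧ ∃ (Ca : ℝ) (da : ℕ), 0 ≤ Ca ∧
          ∀ (σ σ' : ChainConfig) (R δ : ℝ), 1 ≤ R → 0 ≤ δ → δ ≤ 1 →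
            (∀ i : ℤ, -1 ≤ i → i ≤ 1 → |(σ' i).1| ≤ R ∧ |(σ' i).2| ≤ R ∧
              |(σ i).1 - (σ' i).1| ≤ δ ∧ |(σ i).2 - (σ' i).2| ≤ δ) → |a σ - a σ'| ≤ Ca * R ^ da * δ := by
      rcases ha with rfl | rfl
      · obtain ⟨Ca, hCa, hL⟩ := OscillatorChain.exists_polyLipschitz_bondCurrentZ hV1
        exact ⟨measurable_bondCurrentZ _ 0, OscillatorChain.dependsOn_bondCurrentZ_zero _,
          hss.memLp_bondCurrentZ (by norm_num) hU0 hUm hV1 0 ENNReal.ofNat_ne_top,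
          hpow4 (hss.memLp_bondCurrentZ (by norm_num) hU0 hUm hV1 0 ENNReal.ofNat_ne_top),
          Ca, 2 * 2 + 1, hCa, hL⟩
      · obtain ⟨Ca, hCa, hL⟩ := OscillatorChain.exists_polyLipschitz_energyDensityZ hU1 hV1
        exact ⟨OscillatorChain.measurable_energyDensityZ _ hUm hVm 0,
          OscillatorChain.dependsOn_energyDensityZ_zero _,
          hss.memLp_energyDensityZ hU0 hV0 hUm hVm 0 ENNReal.ofNat_ne_top,
          hpow4 (hss.memLp_energyDensityZ hU0 hV0 hUm hVm 0 ENNReal.ofNat_ne_top),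
          Ca, 2 * 2 + 2 * 2 + 1, hCa, hL⟩
    obtain ⟨ham, had, ha2, ha4, Ca, da, hCa, hL⟩ := hdata
    obtain ⟨ε, hε0, hε, hmain⟩ := D'.exists_summable_l2_locality (by norm_num) (by norm_num) hU1 hV1
      hcar' hB1 hss hD' hsev ham had ha2 ha4 hCa hL τ hτ
    refine ⟨ε, hε0, hε, fun t ht n => ?_⟩
    obtain ⟨h1, h2, h3, h4⟩ := hmain t ht n
    exact ⟨_, h1, h2, h3, h4⟩
  -- continuity in time of the two-point functions of the generators
  have hcontj : ∀ x : ℤ, Continuous fun t : ℝ => ∫ σ, (pinnedChain ω₂ lam β γ).bondCurrentZ σ 0 *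
      (pinnedChain ω₂ lam β γ).bondCurrentZ (chainShift x (D'.flow t σ)) 0 ∂μ := by
    intro x
    simp only [OscillatorChain.bondCurrentZ_chainShift]
    exact D'.continuous_integral_bondCurrentZ_mul_flow hss (by norm_num) hU0 hUm hV1 hD' (0 + x) 0
  have hconth : ∀ x : ℤ, Continuous fun t : ℝ => ∫ σ, (pinnedChain ω₂ lam β γ).energyDensityZ σ 0 *
      (pinnedChain ω₂ lam β γ).energyDensityZ (chainShift x (D'.flow t σ)) 0 ∂μ := by
    intro x
    simp only [OscillatorChain.energyDensityZ_chainShift]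
    exact D'.continuous_integral_energyDensityZ_mul_flow hss hU0 hUc hV1 hD' (0 + x) 0
  -- `C_μ(0) > 0` for `D'`
  have h0 : 0 < D'.currentCorrelation μ 0 := by
    rw [hcorr 0]
    exact hG3 μ hG hS hss hD
  -- 3. assembly for `D'`, then back to `D`
  obtain ⟨hA, hP⟩ := D'.transportRegular_of_mixing_of_locality (by norm_num) hU0 hUm hV1 hcar' hoff
    hG hS hss hD' huniq (hmix μ hG hS hss) hloc hcontj hconth h0
  refine ⟨fun t => (habs t).1 (hA t), fun ν hν => ?_⟩
  have h := hP ν hν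
  simp only [hcorr] at h
  exact h

end Summit.AtomisticToContinuum.FouriersLaw.Theorems.GreenKuboContinuation.TemperatureBlindVitaliHurwitz

end
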